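import Literature.Probability.RandomPlanarGeometry.SAWCountZdSymbolSecondLowerCount
import Literature.Probability.RandomPlanarGeometry.SAWCountZdSymbolThirdCoefficient
import HarnessLib

/-!
# THE THIRD-LAYER LOWER CENSUS: `W'_j = (2j−5)·G_j·2^{2j−4}` for every `j ≥ 4` — a quadruple or two triples, one triple with a tripled block axis, or two tripled block axes

Topic `Literature/Probability/RandomPlanarGeometry` (the «SYMBOL POLYNOMIALITY» programme; on `SAWCountZdSymbolSecondLowerCount.lean` (a-p1 g26: `twoParts`, (G1)
`card_twoParts_of_card_eq`, (G2) `card_twoParts_of_card_eq_succ`, the (A, B, ρ) data `abData` and ★★ `card_goodParts_eq_card_abData`, `card_outerPos`),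
`SAWCountZdSymbolBlockData.lean` (a-p1 g26: the one-block bijection `card_shapeClass_topVec`), `SAWCountZdSymbolThirdCoefficient.lean` (a-p1 g26: `thirdShapeSumLow`),
λ1 `SAWCountZdSymbolTopShapes.lean` (`exists_eq_topVec_of_mem_shapeClass`, `topVec_injOn`), the perfect matchings `pairPartitions` of `HiggsFluctMeasureWickPairings.lean`
(Glimm–Jaffe (3.2.13))).

PRINTED CONTEXT (locators only; nothing is quoted digit-for-digit). Madras–Slade (1993) §1.1 eq. (1.1.8) p. 5, Definition 1.2.4, §1.2 p. 10; Clisby–Liang–Slade (2007)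
§3.3 eqs. (29)/(31); Glimm–Jaffe (1987) (3.2.13) (the `(2n−1)‼` pairings); Stanley EC1 §1.3 (set partitions with prescribed block sizes). NOT IN PRINT as far as the lane's
desks could locate: the statements below (lane theorems about the lane's shape classes).

THE THEOREM. The third-layer LOWER corner of the symbol polynomial `R_j` (`SAWCountZdSymbolThirdCoefficient.coeff_symbolPoly_two_mul_sub_five`) is the sum
`W'_j = thirdShapeSumLow j` of the shape-class sizes on `2j − 2` letters with `2j − 5` breaks. Such a class is non-empty only for a one-block vector `topVec (2j−2) p`
(λ1), of size `#goodParts (2j−2) j p · 2^{2j−4}` (one-block bijection), and `#goodParts = #abData` is the (A, B, ρ) sum over disjoint `A, B` inside the `2j − 6 = 2k + 2`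
outside positions (`k = j − 4` further blocks) of `#twoParts (outside ∖ (A ∪ B)) k`. HERE: (G3) ★★ `card_twoParts_of_card_eq_add_two` — on `2k + 2` points the partitions
into `k` blocks of size `≥ 2` number **`C(2k+2,4)(2k−3)‼ + 10·C(2k+2,6)(2k−5)‼`** (★ `blocks_of_mem_twoParts_add_two`: excess two = one QUADRUPLE + pairs (`quadData`,
a bijection) or TWO TRIPLES + pairs (counted twice by (triple, (G2)-partition of the rest): `two_mul_card_twoTriples`, `C(2k+2,3)C(2k−1,3) = 20·C(2k+2,6)`)); ★★
`sum_card_twoParts_pairs_add_two` — the (A, B) sum on `2k + 2` points: `#A + #B = 0` gives (G3), `= 1` gives `2(2k+2)` copies of (G2) `C(2k+1,3)(2k−3)‼`, `= 2` gives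
`2(2k+2)(2k+1)` copies of (G1) `(2k−1)‼` (`card_disjPairs_two`), `≥ 3` nothing. Hence ★★ `card_goodParts_thirdLower`: **`#goodParts (2j−2) j p = G_j`** with
`G_j = thirdLowerG j = 2(2j−6)(2j−7)(2j−9)‼ + 2(2j−6)C(2j−7,3)(2j−11)‼ + C(2j−6,4)(2j−11)‼ + 10·C(2j−6,6)(2j−13)‼` (`4, 33, 325, 3850` for `j = 4…7`), ★★★
`card_shapeClass_thirdLower`: **`#shapeClass j (2j−2) (topVec (2j−2) p) = G_j·2^{2j−4}`** for every `p + 4 ≤ 2j − 2`, and ★★★ `thirdShapeSumLow_eq`: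
**`W'_j = (2j−5)·G_j·2^{2j−4}` for every `j ≥ 4`** — the lane's censuses `W'_4 = 192`, `W'_5 = 10560`, `W'_6 = 582400` and the BLIND-PREDICTED `W'_7 = M_7(12,9) = 35 481 600`,
`W'_8 = M_8(14,11) = 2 412 748 800` (register «Am. BR» cells BR-1/BR-4, kit j307575/j307576 HIT) are its instances (`thirdShapeSumLow_seven`); and `thirdShapeSumLow_three`:
`W'_3 = 0` (one axis cannot fill the block `x y x̄ ȳ`). One of the three census identities that make the THIRD CANCELLATION of `SAWCountZdSymbolThirdCancellation.lean` unconditional.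
Tool notions (the lane's): `quadData`, `quadOf`, `twoTripleData`, `thirdLowerG`.

THIS FILE (lane «pcv-sawmu», a-p1 g27; all PROVED, standard axioms): ★ `blocks_of_mem_twoParts_add_two`, `quadData`, `quadOf`, `quadOf_eq`, ★ `card_twoParts_filter_quad`,
`twoTripleData`, `insert_mem_twoParts_of_mem_twoTripleData`, ★ `two_mul_card_twoTriples`, `choose_three_mul_choose_three` (private), ★★ `card_twoParts_of_card_eq_add_two`,
`card_disjPairs_two` (private), ★★ `sum_card_twoParts_pairs_add_two`, `thirdLowerG`, ★★ `card_abData_thirdLower`, ★★ `card_goodParts_thirdLower`,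
★★★ `card_shapeClass_thirdLower`, ★★★ `thirdShapeSumLow_eq`, `thirdShapeSumLow_seven`, `thirdShapeSumLow_three`.
[cite: MadrasSlade1993, §1.1 eq. (1.1.8) p. 5; Definition 1.2.4; §1.2 (p. 10)] [cite: ClisbyLiangSlade2007, §3.3 eqs. (29)/(31)] [cite: GlimmJaffeQP1987, (3.2.13) §3.2]
[cite: Stanley2012EC1, §1.3]

Provenance: lane «pcv-sawmu», a-p1 g27 (2026-08-28).
-/

open Finset
open scoped BigOperators
open Literature.Probability.LatticeModels
open Literature.Probability.RandomPlanarGeometry.SAW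
open Literature.Probability.Percolation
open Literature.MathematicalPhysics.QuantumFieldTheory.Balaban1983to89
open Literature.MathematicalPhysics.QuantumFieldTheory.Balaban1983to89.HiggsFluctMeasureWickPairings

namespace Literature.Probability.RandomPlanarGeometry.SAW.Zd

namespace WordTypes

variable {m : ℕ}

/-! ### (G3) `2k + 2` elements: one quadruple and pairs, or two triples and pairs -/

/-- ★ In `ρ ∈ twoParts W k` with `#W = 2k + 2` (excess two) either exactly one block has size `4` and the others size `2`, or every block has size `≤ 3` and exactly
two have size `3`. [cite: Stanley2012EC1, §1.3; lane lemma] -/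
theorem blocks_of_mem_twoParts_add_two {W : Finset (Fin m)} {k : ℕ} (hW : W.card = 2 * k + 2) {ρ : Finset (Finset (Fin m))} (h : ρ ∈ twoParts W k) :
    (∃ Q ∈ ρ, Q.card = 4 ∧ ∀ B ∈ ρ, B ≠ Q → B.card = 2) ∨ ((∀ B ∈ ρ, B.card ≤ 3) ∧ (ρ.filter fun B => B.card = 3).card = 2) := by
  classical
  have hsum := sum_card_sub_two_of_mem_twoParts h
  rw [mem_twoParts] at h
  obtain ⟨-, h2, -⟩ := h
  have hs : ∑ B ∈ ρ, (B.card - 2) = 2 := by omega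
  have hle : ∀ B ∈ ρ, B.card - 2 ≤ 2 := fun B hB => by
    have := Finset.single_le_sum (f := fun B : Finset (Fin m) => B.card - 2) (fun _ _ => Nat.zero_le _) hB
    omega
  by_cases hq : ∃ Q ∈ ρ, Q.card = 4
  · obtain ⟨Q, hQ, hQ4⟩ := hq
    refine Or.inl ⟨Q, hQ, hQ4, fun B hB hBQ => ?_⟩
    have hB2 := h2 B hB
    by_contra hB3
    have hBpos : 1 ≤ B.card - 2 := by omega
    have : Q.card - 2 + (B.card - 2) ≤ ∑ B ∈ ρ, (B.card - 2) := by
      rw [← Finset.sum_pair (f := fun B : Finset (Fin m) => B.card - 2) hBQ.symm]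
      exact Finset.sum_le_sum_of_subset_of_nonneg (fun x hx => by
        rw [Finset.mem_insert, Finset.mem_singleton] at hx; rcases hx with rfl | rfl <;> assumption) (fun _ _ _ => Nat.zero_le _)
    omega
  · push Not at hq
    have h3 : ∀ B ∈ ρ, B.card ≤ 3 := fun B hB => by
      have := hle B hB; have := hq B hB; omega
    refine Or.inr ⟨h3, ?_⟩
    have hterm : ∀ B ∈ ρ, B.card - 2 = if B.card = 3 then 1 else 0 := fun B hB => by
      have := h2 B hB; have := h3 B hB; split_ifs <;> omega
    rw [Finset.sum_congr rfl hterm, Finset.sum_boole] at hs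
    exact_mod_cast hs

open Classical in
/-- The quadruple data: a `4`-subset `t ⊆ W` and a perfect matching of `W ∖ t`. [cite: Stanley2012EC1, §1.3; lane tool notion] -/
noncomputable def quadData (W : Finset (Fin m)) : Finset (Σ _ : Finset (Fin m), Finset (Finset (Fin m))) :=
  (W.powersetCard 4).sigma fun t => pairPartitions (W \ t)

open Classical in
/-- The unique quadruple of `ρ` (junk `∅` if none). [cite: Stanley2012EC1, §1.3; lane tool notion] -/
noncomputable def quadOf (ρ : Finset (Finset (Fin m))) : Finset (Fin m) :=
  if h : ∃ T ∈ ρ, T.card = 4 then h.choose else ∅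

/-- `quadOf ρ` is the size-4 block when there is exactly one. [cite: Stanley2012EC1, §1.3; lane plumbing] -/
theorem quadOf_eq {ρ : Finset (Finset (Fin m))} {T : Finset (Fin m)} (hT : T ∈ ρ) (hT4 : T.card = 4) (huniq : ∀ B ∈ ρ, B ≠ T → B.card = 2) :
    quadOf ρ = T := by
  classical
  have hex : ∃ T ∈ ρ, T.card = 4 := ⟨T, hT, hT4⟩
  unfold quadOf
  rw [dif_pos hex]
  by_contra hne
  have := huniq _ hex.choose_spec.1 hne
  have := hex.choose_spec.2
  omega

open Classical in
/-- ★ The partitions with a quadruple are in bijection with the quadruple data: `#{ρ ∈ twoParts W k | ∃ Q ∈ ρ, #Q = 4} = C(2k+2, 4)·(2k−3)‼` (`#W = 2k + 2`).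
[cite: Stanley2012EC1, §1.3; lane lemma] -/
theorem card_twoParts_filter_quad {W : Finset (Fin m)} {k : ℕ} (hW : W.card = 2 * k + 2) :
    ((twoParts W k).filter fun ρ => ∃ Q ∈ ρ, Q.card = 4).card = (2 * k + 2).choose 4 * (2 * k - 3).doubleFactorial := by
  have htarget : (quadData W).card = (2 * k + 2).choose 4 * (2 * k - 3).doubleFactorial := by
    unfold quadData
    rw [Finset.card_sigma, Finset.sum_const_nat (m := (2 * k - 3).doubleFactorial), Finset.card_powersetCard, hW]
    intro t ht
    rw [Finset.mem_powersetCard] at ht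
    rcases Nat.lt_or_ge k 1 with hk | hk
    · exfalso; have := Finset.card_le_card ht.1; omega
    · rw [card_pairPartitions_of_card_eq_two_mul (n := k - 1) (by rw [Finset.card_sdiff_of_subset ht.1, hW, ht.2]; omega)]
      congr 1; omega
  rw [← htarget]
  refine Finset.card_nbij' (fun ρ => ⟨quadOf ρ, ρ.erase (quadOf ρ)⟩) (fun d => insert d.1 d.2) (fun ρ hρ => ?_) (fun d hd => ?_)
    (fun ρ hρ => ?_) (fun d hd => ?_)
  · -- into the quadruple data
    rw [Finset.mem_coe, Finset.mem_filter] at hρ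
    obtain ⟨hρ, hex⟩ := hρ
    rcases blocks_of_mem_twoParts_add_two hW hρ with ⟨T, hT, hT4, huniq⟩ | ⟨h3, -⟩
    · have hρ' := (mem_twoParts.1 hρ).1
      dsimp only
      rw [quadOf_eq hT hT4 huniq]
      unfold quadData
      rw [Finset.mem_coe, Finset.mem_sigma, Finset.mem_powersetCard, mem_pairPartitions]
      exact ⟨⟨hρ'.subset hT, hT4⟩, hρ'.erase hT, fun B hB => huniq B (Finset.mem_of_mem_erase hB) (Finset.ne_of_mem_erase hB)⟩
    · exfalso; obtain ⟨Q, hQ, hQ4⟩ := hex; have := h3 Q hQ; omega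
  · -- from the quadruple data
    obtain ⟨t, σ⟩ := d
    unfold quadData at hd
    rw [Finset.mem_coe, Finset.mem_sigma, Finset.mem_powersetCard, mem_pairPartitions] at hd
    obtain ⟨⟨htW, ht4⟩, hσ, hσ2⟩ := hd
    dsimp only at htW ht4 hσ hσ2 ⊢
    have hins : IsSetPartition W (insert t σ) := hσ.insert htW (by rw [← Finset.card_pos, ht4]; norm_num)
    have htσ : t ∉ σ := hσ.notMem_of_sdiff (by rw [← Finset.card_pos, ht4]; norm_num)
    rw [Finset.mem_coe, Finset.mem_filter, mem_twoParts]
    refine ⟨⟨hins, fun B hB => ?_, ?_⟩, t, Finset.mem_insert_self _ _, ht4⟩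
    · rcases Finset.mem_insert.1 hB with hBt | hB
      · rw [hBt, ht4]; norm_num
      · rw [hσ2 B hB]
    · rw [Finset.card_insert_of_notMem htσ]
      have := card_eq_two_mul_of_mem_pairPartitions (mem_pairPartitions.2 ⟨hσ, hσ2⟩)
      rw [Finset.card_sdiff_of_subset htW, hW, ht4] at this
      have := Finset.card_le_card htW
      rw [hW, ht4] at this
      omega
  · -- left inverse
    rw [Finset.mem_coe, Finset.mem_filter] at hρ
    obtain ⟨hρ, hex⟩ := hρ
    rcases blocks_of_mem_twoParts_add_two hW hρ with ⟨T, hT, hT4, huniq⟩ | ⟨h3, -⟩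
    · simp only [quadOf_eq hT hT4 huniq, Finset.insert_erase hT]
    · exfalso; obtain ⟨Q, hQ, hQ4⟩ := hex; have := h3 Q hQ; omega
  · -- right inverse
    obtain ⟨t, σ⟩ := d
    unfold quadData at hd
    rw [Finset.mem_coe, Finset.mem_sigma, Finset.mem_powersetCard, mem_pairPartitions] at hd
    obtain ⟨⟨htW, ht4⟩, hσ, hσ2⟩ := hd
    dsimp only at htW ht4 hσ hσ2 ⊢
    have htσ : t ∉ σ := hσ.notMem_of_sdiff (by rw [← Finset.card_pos, ht4]; norm_num)
    have htr : quadOf (insert t σ) = t :=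
      quadOf_eq (Finset.mem_insert_self _ _) ht4 (fun B hB hBt => by
        rcases Finset.mem_insert.1 hB with rfl | hB
        · exact absurd rfl hBt
        · exact hσ2 B hB)
    simp only [htr, Finset.erase_insert htσ]

open Classical in
/-- The two-triple data (ordered): a `3`-subset `t ⊆ W` and a partition of `W ∖ t` into `k − 1` blocks of size `≥ 2` (which, on `2k − 1` points, is one more triple and pairs).
[cite: Stanley2012EC1, §1.3; lane tool notion] -/
noncomputable def twoTripleData (W : Finset (Fin m)) (k : ℕ) : Finset (Σ _ : Finset (Fin m), Finset (Finset (Fin m))) :=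
  (W.powersetCard 3).sigma fun t => twoParts (W \ t) (k - 1)

/-- Inserting the marked triple gives a partition with no quadruple (`#W = 2k + 2`, `k ≥ 1`). [cite: Stanley2012EC1, §1.3; lane plumbing] -/
theorem insert_mem_twoParts_of_mem_twoTripleData {W : Finset (Fin m)} {k : ℕ} (hW : W.card = 2 * k + 2) (hk : 1 ≤ k)
    {d : Σ _ : Finset (Fin m), Finset (Finset (Fin m))} (hd : d ∈ twoTripleData W k) :
    insert d.1 d.2 ∈ (twoParts W k).filter (fun ρ => ¬ ∃ Q ∈ ρ, Q.card = 4) ∧ d.1 ∉ d.2 := by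
  classical
  obtain ⟨t, σ⟩ := d
  unfold twoTripleData at hd
  rw [Finset.mem_sigma, Finset.mem_powersetCard] at hd
  obtain ⟨⟨htW, ht3⟩, hσ⟩ := hd
  dsimp only at htW ht3 hσ ⊢
  have hWt : (W \ t).card = 2 * (k - 1) + 1 := by rw [Finset.card_sdiff_of_subset htW, hW, ht3]; omega
  obtain ⟨T, hT, hT3, huniq⟩ := exists_unique_triple_of_mem_twoParts hWt hσ
  rw [mem_twoParts] at hσ
  obtain ⟨hσ, hσ2, hσk⟩ := hσ
  have htσ : t ∉ σ := hσ.notMem_of_sdiff (by rw [← Finset.card_pos, ht3]; norm_num)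
  have hins : IsSetPartition W (insert t σ) := hσ.insert htW (by rw [← Finset.card_pos, ht3]; norm_num)
  refine ⟨Finset.mem_filter.2 ⟨mem_twoParts.2 ⟨hins, fun B hB => ?_, ?_⟩, ?_⟩, htσ⟩
  · rcases Finset.mem_insert.1 hB with hBt | hB
    · rw [hBt, ht3]; norm_num
    · exact hσ2 B hB
  · rw [Finset.card_insert_of_notMem htσ, hσk]; omega
  · rintro ⟨Q, hQ, hQ4⟩
    rcases Finset.mem_insert.1 hQ with hQt | hQ
    · rw [hQt, ht3] at hQ4; omega
    · by_cases hQT : Q = T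
      · rw [hQT, hT3] at hQ4; omega
      · rw [huniq Q hQ hQT] at hQ4; omega

open Classical in
/-- ★ The partitions with two triples, counted twice: `2·#{ρ ∈ twoParts W k | no quadruple} = C(2k+2,3)·C(2k−1,3)·(2k−5)‼` (`#W = 2k + 2`, `k ≥ 1`) — the map
`(t, ρ') ↦ insert t ρ'` from the two-triple data is two-to-one (either triple can be the marked one). [cite: Stanley2012EC1, §1.3; lane lemma] -/
theorem two_mul_card_twoTriples {W : Finset (Fin m)} {k : ℕ} (hW : W.card = 2 * k + 2) (hk : 1 ≤ k) :
    2 * ((twoParts W k).filter fun ρ => ¬ ∃ Q ∈ ρ, Q.card = 4).card = (2 * k + 2).choose 3 * ((2 * k - 1).choose 3 * (2 * k - 5).doubleFactorial) := by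
  set P33 := (twoParts W k).filter fun ρ => ¬ ∃ Q ∈ ρ, Q.card = 4 with hP33
  have hsrc : (twoTripleData W k).card = (2 * k + 2).choose 3 * ((2 * k - 1).choose 3 * (2 * k - 5).doubleFactorial) := by
    unfold twoTripleData
    rw [Finset.card_sigma, Finset.sum_const_nat (m := (2 * k - 1).choose 3 * (2 * k - 5).doubleFactorial), Finset.card_powersetCard, hW]
    intro t ht
    rw [Finset.mem_powersetCard] at ht
    rw [card_twoParts_of_card_eq_succ (k := k - 1) (by rw [Finset.card_sdiff_of_subset ht.1, hW, ht.2]; omega)]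
    have e1 : 2 * (k - 1) + 1 = 2 * k - 1 := by omega
    have e2 : 2 * (k - 1) - 3 = 2 * k - 5 := by omega
    rw [e1, e2]
  have hmaps : Set.MapsTo (fun d : (Σ _ : Finset (Fin m), Finset (Finset (Fin m))) => insert d.1 d.2) ↑(twoTripleData W k) ↑P33 :=
    fun d hd => (insert_mem_twoParts_of_mem_twoTripleData hW hk hd).1
  have hfib := Finset.card_eq_sum_card_fiberwise hmaps
  -- every fibre has exactly two elements: the two triples of `ρ`
  have hfib2 : ∀ ρ ∈ P33, ((twoTripleData W k).filter fun d => insert d.1 d.2 = ρ).card = 2 := by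
    intro ρ hρ
    rw [hP33, Finset.mem_filter] at hρ
    obtain ⟨hρ, hnq⟩ := hρ
    rcases blocks_of_mem_twoParts_add_two hW hρ with ⟨Q, hQ, hQ4, -⟩ | ⟨h3, htwo⟩
    · exact absurd ⟨Q, hQ, hQ4⟩ hnq
    · rw [← htwo]
      have hρ' := (mem_twoParts.1 hρ).1
      have hρ2 := (mem_twoParts.1 hρ).2.1
      have hρk := (mem_twoParts.1 hρ).2.2
      refine Finset.card_nbij' (fun d => d.1) (fun T => ⟨T, ρ.erase T⟩) (fun d hd => ?_) (fun T hT => ?_) (fun d hd => ?_) (fun T hT => ?_)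
      · rw [Finset.mem_coe, Finset.mem_filter] at hd
        obtain ⟨hd, hdρ⟩ := hd
        have ht3 : d.1.card = 3 := by
          unfold twoTripleData at hd; rw [Finset.mem_sigma, Finset.mem_powersetCard] at hd; exact hd.1.2
        rw [Finset.mem_coe, Finset.mem_filter]
        exact ⟨by rw [← hdρ]; exact Finset.mem_insert_self _ _, ht3⟩
      · rw [Finset.mem_coe, Finset.mem_filter] at hT
        obtain ⟨hT, hT3⟩ := hT
        rw [Finset.mem_coe, Finset.mem_filter]
        refine ⟨?_, Finset.insert_erase hT⟩
        unfold twoTripleData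
        rw [Finset.mem_sigma, Finset.mem_powersetCard]
        refine ⟨⟨hρ'.subset hT, hT3⟩, mem_twoParts.2 ⟨hρ'.erase hT, fun B hB => hρ2 B (Finset.mem_of_mem_erase hB), ?_⟩⟩
        rw [Finset.card_erase_of_mem hT, hρk]
      · rw [Finset.mem_coe, Finset.mem_filter] at hd
        obtain ⟨hd, hdρ⟩ := hd
        obtain ⟨-, hnot⟩ := insert_mem_twoParts_of_mem_twoTripleData hW hk hd
        obtain ⟨t, σ⟩ := d
        dsimp only at hdρ hnot ⊢
        simp only [← hdρ, Finset.erase_insert hnot]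
      · rfl
  rw [← hsrc, hfib, Finset.sum_congr rfl hfib2, Finset.sum_const, smul_eq_mul, mul_comm]

/-- `C(n,3)·C(n−3,3) = 20·C(n,6)` (generic; `Nat.choose_mul`). [cite: Stanley2012EC1, §1.3; lane plumbing] -/
private theorem choose_three_mul_choose_three (n : ℕ) : n.choose 3 * (n - 3).choose 3 = 20 * n.choose 6 := by
  have h := Nat.choose_mul (n := n) (k := 6) (s := 3) (by norm_num)
  rw [show Nat.choose 6 3 = 20 by decide, show 6 - 3 = 3 by norm_num] at h
  rw [← h, mul_comm]

open Classical in
/-- ★★ (G3) count: `#twoParts W k = C(2k+2,4)·(2k−3)‼ + 10·C(2k+2,6)·(2k−5)‼` when `#W = 2k + 2`. [cite: Stanley2012EC1, §1.3; lane theorem] -/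
theorem card_twoParts_of_card_eq_add_two {W : Finset (Fin m)} {k : ℕ} (hW : W.card = 2 * k + 2) :
    (twoParts W k).card = (2 * k + 2).choose 4 * (2 * k - 3).doubleFactorial + 10 * (2 * k + 2).choose 6 * (2 * k - 5).doubleFactorial := by
  rcases Nat.lt_or_ge k 1 with hk | hk
  · -- `k = 0`: no partition of a non-empty set into no blocks
    have hk0 : k = 0 := by omega
    subst hk0
    have : twoParts W 0 = ∅ := by
      rw [Finset.eq_empty_iff_forall_notMem]
      intro ρ hρ
      rw [mem_twoParts] at hρ
      obtain ⟨hρ, -, h0⟩ := hρ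
      have := hρ.sum_card
      rw [Finset.card_eq_zero.1 h0, Finset.sum_empty, hW] at this
      omega
    rw [this, Finset.card_empty]
    decide
  · have hsplit := Finset.card_filter_add_card_filter_not (s := twoParts W k) (fun ρ => ∃ Q ∈ ρ, Q.card = 4)
    have h2 := two_mul_card_twoTriples hW hk
    have h2' : ((twoParts W k).filter fun ρ => ¬ ∃ Q ∈ ρ, Q.card = 4).card = 10 * (2 * k + 2).choose 6 * (2 * k - 5).doubleFactorial := by
      have : 2 * ((twoParts W k).filter fun ρ => ¬ ∃ Q ∈ ρ, Q.card = 4).card = 2 * (10 * (2 * k + 2).choose 6 * (2 * k - 5).doubleFactorial) := by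
        rw [h2, show 2 * k - 1 = (2 * k + 2) - 3 by omega, ← mul_assoc, choose_three_mul_choose_three]; ring
      omega
    rw [card_twoParts_filter_quad hW, h2'] at hsplit
    omega

/-! ### The (A, B) sum on `2k + 2` outside positions -/

/-- The disjoint pairs `(A, B)` with `#A + #B = 2` inside an `n`-set: `2·C(n,2) + (n² − n)`. [cite: Stanley2012EC1, §1.3; lane plumbing] -/
private theorem card_disjPairs_two (O : Finset (Fin m)) :
    (((O.powerset ×ˢ O.powerset).filter (fun AB : Finset (Fin m) × Finset (Fin m) => Disjoint AB.1 AB.2)).filter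
        (fun AB => AB.1.card + AB.2.card = 2)).card = 2 * O.card.choose 2 + (O.card * O.card - O.card) := by
  classical
  have hdesc : (((O.powerset ×ˢ O.powerset).filter (fun AB : Finset (Fin m) × Finset (Fin m) => Disjoint AB.1 AB.2)).filter
      (fun AB => AB.1.card + AB.2.card = 2)) =
      (O.powersetCard 2).image (fun t => (t, (∅ : Finset (Fin m)))) ∪ (O.powersetCard 2).image (fun t => ((∅ : Finset (Fin m)), t)) ∪
        O.offDiag.image (fun ab => (({ab.1} : Finset (Fin m)), ({ab.2} : Finset (Fin m)))) := by
    ext AB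
    rw [Finset.mem_filter, Finset.mem_filter, Finset.mem_product, Finset.mem_powerset, Finset.mem_powerset, Finset.mem_union, Finset.mem_union,
      Finset.mem_image, Finset.mem_image, Finset.mem_image]
    constructor
    · rintro ⟨⟨⟨hA, hB⟩, hd⟩, hs⟩
      rcases Nat.eq_zero_or_pos AB.2.card with h0 | hpos
      · refine Or.inl (Or.inl ⟨AB.1, Finset.mem_powersetCard.2 ⟨hA, by omega⟩, ?_⟩)
        rw [← Finset.card_eq_zero.1 h0]
      · rcases Nat.eq_zero_or_pos AB.1.card with h1 | h1pos
        · refine Or.inl (Or.inr ⟨AB.2, Finset.mem_powersetCard.2 ⟨hB, by omega⟩, ?_⟩)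
          rw [← Finset.card_eq_zero.1 h1]
        · have ha : AB.1.card = 1 := by omega
          have hb : AB.2.card = 1 := by omega
          obtain ⟨a, ha'⟩ := Finset.card_eq_one.1 ha
          obtain ⟨b, hb'⟩ := Finset.card_eq_one.1 hb
          refine Or.inr ⟨(a, b), Finset.mem_offDiag.2 ⟨hA (by rw [ha']; simp), hB (by rw [hb']; simp), fun hab => ?_⟩, ?_⟩
          · simp only at hab; rw [ha', hb', hab] at hd; simp at hd
          · rw [← ha', ← hb']
    · rintro ((⟨t, ht, rfl⟩ | ⟨t, ht, rfl⟩) | ⟨ab, hab, rfl⟩)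
      · rw [Finset.mem_powersetCard] at ht
        exact ⟨⟨⟨ht.1, Finset.empty_subset _⟩, disjoint_bot_right⟩, by simp [ht.2]⟩
      · rw [Finset.mem_powersetCard] at ht
        exact ⟨⟨⟨Finset.empty_subset _, ht.1⟩, disjoint_bot_left⟩, by simp [ht.2]⟩
      · rw [Finset.mem_offDiag] at hab
        exact ⟨⟨⟨by simpa using hab.1, by simpa using hab.2.1⟩, by simpa using hab.2.2⟩, by simp⟩
  rw [hdesc]
  have hd1 : Disjoint ((O.powersetCard 2).image (fun t => (t, (∅ : Finset (Fin m))))) ((O.powersetCard 2).image (fun t => ((∅ : Finset (Fin m)), t))) := by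
    rw [Finset.disjoint_left]
    rintro AB h1 h2
    obtain ⟨t, ht, rfl⟩ := Finset.mem_image.1 h1
    obtain ⟨t', ht', h⟩ := Finset.mem_image.1 h2
    rw [Finset.mem_powersetCard] at ht
    have := congrArg Prod.fst h
    simp only at this
    rw [← this, Finset.card_empty] at ht
    omega
  have hd2 : Disjoint ((O.powersetCard 2).image (fun t => (t, (∅ : Finset (Fin m)))) ∪ (O.powersetCard 2).image (fun t => ((∅ : Finset (Fin m)), t)))
      (O.offDiag.image (fun ab => (({ab.1} : Finset (Fin m)), ({ab.2} : Finset (Fin m))))) := by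
    rw [Finset.disjoint_left]
    rintro AB h1 h2
    obtain ⟨ab, -, rfl⟩ := Finset.mem_image.1 h2
    rcases Finset.mem_union.1 h1 with h1 | h1
    · obtain ⟨t, -, h⟩ := Finset.mem_image.1 h1
      have := congrArg Prod.snd h
      simp at this
    · obtain ⟨t, -, h⟩ := Finset.mem_image.1 h1
      have := congrArg Prod.fst h
      simp at this
  rw [Finset.card_union_of_disjoint hd2, Finset.card_union_of_disjoint hd1,
    Finset.card_image_of_injective _ (fun a b h => by simpa using congrArg Prod.fst h),
    Finset.card_image_of_injective _ (fun a b h => by simpa using congrArg Prod.snd h),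
    Finset.card_image_of_injective _ (fun a b h => by
      obtain ⟨a1, a2⟩ := a; obtain ⟨b1, b2⟩ := b
      simp only [Prod.mk.injEq, Finset.singleton_inj] at h
      exact Prod.ext h.1 h.2),
    Finset.card_powersetCard, Finset.offDiag_card]
  ring

open Classical in
/-- ★★ THE (A, B) SUM ON `2k + 2` OUTSIDE POSITIONS: `Σ_{A, B ⊆ O disjoint} #twoParts (O ∖ (A ∪ B)) k = [C(2k+2,4)(2k−3)‼ + 10C(2k+2,6)(2k−5)‼] +
2(2k+2)·C(2k+1,3)(2k−3)‼ + 2(2k+2)(2k+1)·(2k−1)‼` — `#A + #B = 0` (a quadruple or two triples), `= 1` (one triple), `= 2` (perfect matchings), `≥ 3` empty.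
[cite: MadrasSlade1993, Definition 1.2.4; lane lemma] -/
theorem sum_card_twoParts_pairs_add_two {O : Finset (Fin m)} {k : ℕ} (hOc : O.card = 2 * k + 2) :
    ∑ AB ∈ (O.powerset ×ˢ O.powerset).filter (fun AB => Disjoint AB.1 AB.2), (twoParts (O \ (AB.1 ∪ AB.2)) k).card =
      ((2 * k + 2).choose 4 * (2 * k - 3).doubleFactorial + 10 * (2 * k + 2).choose 6 * (2 * k - 5).doubleFactorial) +
        2 * (2 * k + 2) * ((2 * k + 1).choose 3 * (2 * k - 3).doubleFactorial) + 2 * (2 * k + 2) * (2 * k + 1) * (2 * k - 1).doubleFactorial := by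
  set D := (O.powerset ×ˢ O.powerset).filter (fun AB : Finset (Fin m) × Finset (Fin m) => Disjoint AB.1 AB.2) with hD
  have hmemD : ∀ AB ∈ D, AB.1 ⊆ O ∧ AB.2 ⊆ O ∧ Disjoint AB.1 AB.2 := by
    intro AB hAB
    rw [hD, Finset.mem_filter, Finset.mem_product, Finset.mem_powerset, Finset.mem_powerset] at hAB
    exact ⟨hAB.1.1, hAB.1.2, hAB.2⟩
  have hg0 : ∀ AB ∈ D, 3 ≤ AB.1.card + AB.2.card → (twoParts (O \ (AB.1 ∪ AB.2)) k).card = 0 := by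
    intro AB hAB hs
    obtain ⟨hA, hB, hd⟩ := hmemD AB hAB
    have hle := Finset.card_le_card (Finset.union_subset hA hB)
    rw [Finset.card_union_of_disjoint hd, hOc] at hle
    rw [twoParts_eq_empty_of_lt (W := O \ (AB.1 ∪ AB.2)) (k := k) (by
      rw [Finset.card_sdiff_of_subset (Finset.union_subset hA hB), Finset.card_union_of_disjoint hd, hOc]; omega), Finset.card_empty]
  have hg1 : ∀ AB ∈ D, AB.1.card + AB.2.card = 1 → (twoParts (O \ (AB.1 ∪ AB.2)) k).card = (2 * k + 1).choose 3 * (2 * k - 3).doubleFactorial := by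
    intro AB hAB hs
    obtain ⟨hA, hB, hd⟩ := hmemD AB hAB
    exact card_twoParts_of_card_eq_succ (W := O \ (AB.1 ∪ AB.2)) (k := k) (by
      rw [Finset.card_sdiff_of_subset (Finset.union_subset hA hB), Finset.card_union_of_disjoint hd, hOc]; omega)
  have hg2 : ∀ AB ∈ D, AB.1.card + AB.2.card = 2 → (twoParts (O \ (AB.1 ∪ AB.2)) k).card = (2 * k - 1).doubleFactorial := by
    intro AB hAB hs
    obtain ⟨hA, hB, hd⟩ := hmemD AB hAB
    exact card_twoParts_of_card_eq (W := O \ (AB.1 ∪ AB.2)) (k := k) (by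
      rw [Finset.card_sdiff_of_subset (Finset.union_subset hA hB), Finset.card_union_of_disjoint hd, hOc]; omega)
  -- split the sum by `#A + #B ∈ {0}, {1}, {2}, {≥ 3}`
  have hsplit : ∑ AB ∈ D, (twoParts (O \ (AB.1 ∪ AB.2)) k).card =
      ∑ AB ∈ D.filter (fun AB => AB.1.card + AB.2.card = 0), (twoParts (O \ (AB.1 ∪ AB.2)) k).card +
      (∑ AB ∈ D.filter (fun AB => AB.1.card + AB.2.card = 1), (twoParts (O \ (AB.1 ∪ AB.2)) k).card +
      (∑ AB ∈ D.filter (fun AB => AB.1.card + AB.2.card = 2), (twoParts (O \ (AB.1 ∪ AB.2)) k).card +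
        ∑ AB ∈ D.filter (fun AB => 3 ≤ AB.1.card + AB.2.card), (twoParts (O \ (AB.1 ∪ AB.2)) k).card)) := by
    rw [← Finset.sum_filter_add_sum_filter_not D (fun AB => AB.1.card + AB.2.card = 0)]
    congr 1
    rw [← Finset.sum_filter_add_sum_filter_not (D.filter fun AB => ¬ AB.1.card + AB.2.card = 0) (fun AB => AB.1.card + AB.2.card = 1)]
    congr 1
    · refine Finset.sum_congr ?_ (fun _ _ => rfl)
      ext AB
      simp only [Finset.mem_filter]
      constructor
      · rintro ⟨⟨h1, -⟩, h3⟩; exact ⟨h1, h3⟩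
      · rintro ⟨h1, h3⟩; exact ⟨⟨h1, by omega⟩, h3⟩
    · rw [← Finset.sum_filter_add_sum_filter_not ((D.filter fun AB => ¬ AB.1.card + AB.2.card = 0).filter fun AB => ¬ AB.1.card + AB.2.card = 1)
        (fun AB => AB.1.card + AB.2.card = 2)]
      congr 1
      · refine Finset.sum_congr ?_ (fun _ _ => rfl)
        ext AB
        simp only [Finset.mem_filter]
        constructor
        · rintro ⟨⟨⟨h1, -⟩, -⟩, h3⟩; exact ⟨h1, h3⟩
        · rintro ⟨h1, h3⟩; exact ⟨⟨⟨h1, by omega⟩, by omega⟩, h3⟩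
      · refine Finset.sum_congr ?_ (fun _ _ => rfl)
        ext AB
        simp only [Finset.mem_filter]
        constructor
        · rintro ⟨⟨⟨h1, h2⟩, h4⟩, h3⟩; exact ⟨h1, by omega⟩
        · rintro ⟨h1, h3⟩; exact ⟨⟨⟨h1, by omega⟩, by omega⟩, by omega⟩
  -- `#A + #B = 0`: only `(∅, ∅)`
  have hD0 : D.filter (fun AB => AB.1.card + AB.2.card = 0) = {(∅, ∅)} := by
    ext AB
    rw [Finset.mem_filter, Finset.mem_singleton, hD, Finset.mem_filter, Finset.mem_product, Finset.mem_powerset, Finset.mem_powerset]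
    constructor
    · rintro ⟨-, h⟩
      have h1 : AB.1 = ∅ := Finset.card_eq_zero.1 (by omega)
      have h2 : AB.2 = ∅ := Finset.card_eq_zero.1 (by omega)
      exact Prod.ext h1 h2
    · rintro rfl; simp
  -- `#A + #B = 1`: the two families of singletons
  have hD1 : D.filter (fun AB => AB.1.card + AB.2.card = 1) =
      O.image (fun o => (({o} : Finset (Fin m)), (∅ : Finset (Fin m)))) ∪ O.image (fun o => (∅, {o})) := by
    ext AB
    rw [Finset.mem_filter, Finset.mem_union, Finset.mem_image, Finset.mem_image, hD, Finset.mem_filter, Finset.mem_product, Finset.mem_powerset,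
      Finset.mem_powerset]
    constructor
    · rintro ⟨⟨⟨hA, hB⟩, -⟩, hs⟩
      rcases Nat.eq_zero_or_pos AB.1.card with h1 | h1
      · have h2 : AB.2.card = 1 := by omega
        obtain ⟨o, ho⟩ := Finset.card_eq_one.1 h2
        refine Or.inr ⟨o, hB (by rw [ho]; simp), ?_⟩
        rw [← ho, ← Finset.card_eq_zero.1 h1]
      · have h1' : AB.1.card = 1 := by omega
        obtain ⟨o, ho⟩ := Finset.card_eq_one.1 h1'
        refine Or.inl ⟨o, hA (by rw [ho]; simp), ?_⟩
        rw [← ho, ← Finset.card_eq_zero.1 (show AB.2.card = 0 by omega)]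
    · rintro (⟨o, ho, rfl⟩ | ⟨o, ho, rfl⟩)
      · exact ⟨⟨⟨by simpa using ho, Finset.empty_subset _⟩, by simp⟩, by simp⟩
      · exact ⟨⟨⟨Finset.empty_subset _, by simpa using ho⟩, by simp⟩, by simp⟩
  have hdisj1 : Disjoint (O.image (fun o => (({o} : Finset (Fin m)), (∅ : Finset (Fin m))))) (O.image (fun o => (∅, {o}))) := by
    rw [Finset.disjoint_left]
    rintro AB h1 h2
    obtain ⟨o, -, rfl⟩ := Finset.mem_image.1 h1
    obtain ⟨o', -, h⟩ := Finset.mem_image.1 h2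
    have := congrArg Prod.fst h
    simp at this
  have hsum0 : ∑ AB ∈ D.filter (fun AB => AB.1.card + AB.2.card = 0), (twoParts (O \ (AB.1 ∪ AB.2)) k).card =
      (2 * k + 2).choose 4 * (2 * k - 3).doubleFactorial + 10 * (2 * k + 2).choose 6 * (2 * k - 5).doubleFactorial := by
    rw [hD0, Finset.sum_singleton]
    simp only [Finset.empty_union, Finset.sdiff_empty]
    exact card_twoParts_of_card_eq_add_two hOc
  have hsum1 : ∑ AB ∈ D.filter (fun AB => AB.1.card + AB.2.card = 1), (twoParts (O \ (AB.1 ∪ AB.2)) k).card =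
      2 * (2 * k + 2) * ((2 * k + 1).choose 3 * (2 * k - 3).doubleFactorial) := by
    rw [Finset.sum_congr rfl (fun AB hAB => hg1 AB (Finset.mem_filter.1 hAB).1 (Finset.mem_filter.1 hAB).2), Finset.sum_const, smul_eq_mul, hD1,
      Finset.card_union_of_disjoint hdisj1, Finset.card_image_of_injective _ (fun a b h => by simpa using congrArg Prod.fst h),
      Finset.card_image_of_injective _ (fun a b h => by simpa using congrArg Prod.snd h), hOc]
    ring
  have hsum2 : ∑ AB ∈ D.filter (fun AB => AB.1.card + AB.2.card = 2), (twoParts (O \ (AB.1 ∪ AB.2)) k).card =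
      2 * (2 * k + 2) * (2 * k + 1) * (2 * k - 1).doubleFactorial := by
    rw [Finset.sum_congr rfl (fun AB hAB => hg2 AB (Finset.mem_filter.1 hAB).1 (Finset.mem_filter.1 hAB).2), Finset.sum_const, smul_eq_mul, hD,
      card_disjPairs_two O, hOc, Nat.choose_two_right]
    have h2 : (2 * k + 2) * (2 * k + 2 - 1) / 2 = (k + 1) * (2 * k + 1) := by
      rw [show 2 * k + 2 - 1 = 2 * k + 1 by omega, show (2 * k + 2) * (2 * k + 1) = (k + 1) * (2 * k + 1) * 2 by ring, Nat.mul_div_cancel _ two_pos]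
    rw [h2, show (2 * k + 2) * (2 * k + 2) - (2 * k + 2) = (2 * k + 2) * (2 * k + 1) by
      rw [show (2 * k + 2) * (2 * k + 2) = (2 * k + 2) * (2 * k + 1) + (2 * k + 2) by ring, Nat.add_sub_cancel]]
    ring
  have hsum3 : ∑ AB ∈ D.filter (fun AB => 3 ≤ AB.1.card + AB.2.card), (twoParts (O \ (AB.1 ∪ AB.2)) k).card = 0 :=
    Finset.sum_eq_zero fun AB hAB => hg0 AB (Finset.mem_filter.1 hAB).1 (Finset.mem_filter.1 hAB).2
  rw [hsplit, hsum0, hsum1, hsum2, hsum3, add_zero]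
  ring

/-! ### The lower corner on `2j − 2` letters -/

/-- The THIRD-LAYER LOWER CONSTANT `G_j = #goodParts (2j−2) j p` (any `p`): `2(2j−6)(2j−7)(2j−9)‼ + 2(2j−6)C(2j−7,3)(2j−11)‼ + C(2j−6,4)(2j−11)‼ + 10·C(2j−6,6)(2j−13)‼`
— two tripled block axes, one tripled block axis with an outside triple, an outside quadruple, two outside triples (`G_4 … G_8 = 4, 33, 325, 3850, 53361`).
[cite: MadrasSlade1993, Definition 1.2.4; lane tool notion] -/
def thirdLowerG (j : ℕ) : ℕ :=
  2 * (2 * j - 6) * (2 * j - 7) * (2 * j - 9).doubleFactorial + 2 * (2 * j - 6) * ((2 * j - 7).choose 3 * (2 * j - 11).doubleFactorial) +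
    ((2 * j - 6).choose 4 * (2 * j - 11).doubleFactorial + 10 * (2 * j - 6).choose 6 * (2 * j - 13).doubleFactorial)

section Count

variable {p : ℕ}

open Classical in
/-- ★★ THE (A, B, ρ) COUNT ON `2j − 2` LETTERS: `#abData (2j−2) j p = G_j` (`j ≥ 4`). [cite: MadrasSlade1993, Definition 1.2.4; lane theorem] -/
theorem card_abData_thirdLower {j : ℕ} (hj : 4 ≤ j) (hp : p + 4 ≤ 2 * j - 2) :
    (abData (2 * j - 2) j p hp).card = thirdLowerG j := by
  obtain ⟨k, rfl⟩ : ∃ k, j = k + 4 := ⟨j - 4, by omega⟩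
  unfold abData thirdLowerG
  rw [Finset.card_sigma, show 2 * (k + 4) - 2 - (k + 4) - 2 = k by omega,
    sum_card_twoParts_pairs_add_two (k := k) (by rw [card_outerPos hp]; omega)]
  have e1 : 2 * (k + 4) - 6 = 2 * k + 2 := by omega
  have e2 : 2 * (k + 4) - 7 = 2 * k + 1 := by omega
  have e3 : 2 * (k + 4) - 9 = 2 * k - 1 := by omega
  have e4 : 2 * (k + 4) - 11 = 2 * k - 3 := by omega
  have e5 : 2 * (k + 4) - 13 = 2 * k - 5 := by omega
  rw [e1, e2, e3, e4, e5]
  ring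

/-- ★★ THE GOOD-PARTITION COUNT ON `2j − 2` LETTERS: `#goodParts (2j−2) j p = G_j` (`j ≥ 4`). [cite: MadrasSlade1993, Definition 1.2.4; lane theorem] -/
theorem card_goodParts_thirdLower {j : ℕ} (hj : 4 ≤ j) (hp : p + 4 ≤ 2 * j - 2) :
    (goodParts (2 * j - 2) j p hp).card = thirdLowerG j := by
  rw [card_goodParts_eq_card_abData hp (by omega), card_abData_thirdLower hj hp]

/-- ★★★ THE THIRD-LAYER LOWER CLASS COUNT: `#shapeClass j (2j−2) (topVec (2j−2) p) = G_j · 2^{2j−4}` for every `p + 4 ≤ 2j − 2`, `j ≥ 4` (independent of `p`;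
`64, 2112, 83200, 3942400` per position for `j = 4…7`). [cite: MadrasSlade1993, Definition 1.2.4; lane theorem] -/
theorem card_shapeClass_thirdLower {j p : ℕ} (hj : 4 ≤ j) (hp : p + 4 ≤ 2 * j - 2) :
    (shapeClass j (2 * j - 2) (topVec (2 * j - 2) p)).card = thirdLowerG j * 2 ^ (2 * j - 4) := by
  rw [card_shapeClass_topVec hp, card_goodParts_thirdLower hj hp, show 2 * j - 2 - 2 = 2 * j - 4 by omega]

open Classical in
/-- ★★★ THE THIRD-LAYER LOWER CENSUS FOR EVERY `j ≥ 4`: `W'_j = (2j−5)·G_j·2^{2j−4}`, `W'_j = thirdShapeSumLow j` — the classes with `2j − 5` breaks on `2j − 2`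
letters are the one-block classes `topVec (2j−2) p`, `p ≤ 2j − 6` (λ1), each counted above (the census values `192, 10560, 582400` for `j = 4, 5, 6` and the
BLIND-predicted `M_7(12,9) = 35 481 600`, `M_8(14,11) = 2 412 748 800`, kit j307575 / j307576, register «Am. BR» cells BR-1 / BR-4).
[cite: MadrasSlade1993, §1.1 eq. (1.1.8) p. 5; Definition 1.2.4] [cite: ClisbyLiangSlade2007, §3.3 eqs. (29)/(31); lane theorem] -/
theorem thirdShapeSumLow_eq (j : ℕ) (hj : 4 ≤ j) :
    thirdShapeSumLow j = (2 * j - 5) * (thirdLowerG j * 2 ^ (2 * j - 4)) := by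
  unfold thirdShapeSumLow
  have hval : ∀ p ∈ Finset.range (2 * j - 5),
      (if AdjValid (topVec (2 * j - 2) p) ∧ breaks (topVec (2 * j - 2) p) = 2 * j - 5 then (shapeClass j (2 * j - 2) (topVec (2 * j - 2) p)).card
        else 0) = thirdLowerG j * 2 ^ (2 * j - 4) := by
    intro p hp
    rw [Finset.mem_range] at hp
    have hp4 : p + 4 ≤ 2 * j - 2 := by omega
    rw [if_pos ⟨adjValid_topVec hp4, by rw [breaks_topVec hp4]; omega⟩, card_shapeClass_thirdLower hj hp4]
  have hvan : ∀ A ∈ (Finset.univ : Finset (Fin (2 * j - 2) → Bool)), A ∉ (Finset.range (2 * j - 5)).image (topVec (2 * j - 2)) →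
      (if AdjValid A ∧ breaks A = 2 * j - 5 then (shapeClass j (2 * j - 2) A).card else 0) = 0 := by
    intro A _ hA
    split_ifs with h
    · by_contra hne
      obtain ⟨κ, hκ⟩ := Finset.card_pos.1 (Nat.pos_of_ne_zero hne)
      obtain ⟨p, hp4, rfl⟩ := exists_eq_topVec_of_mem_shapeClass (by rw [h.2]; omega) hκ
      exact hA (Finset.mem_image.2 ⟨p, Finset.mem_range.2 (by omega), rfl⟩)
    · rfl
  have hinj : Set.InjOn (topVec (2 * j - 2)) ↑(Finset.range (2 * j - 5)) := by
    intro p hp p' hp' h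
    rw [Finset.mem_coe, Finset.mem_range] at hp hp'
    exact topVec_injOn (by omega) (by omega) h
  rw [← Finset.sum_subset (Finset.subset_univ _) hvan, Finset.sum_image hinj, Finset.sum_congr rfl hval, Finset.sum_const, Finset.card_range,
    smul_eq_mul]

/-- The instances `j = 4, …, 8`: `W'_4 = 192`, `W'_5 = 10560`, `W'_6 = 582400`, `W'_7 = 35 481 600` (BR-1), `W'_8 = 2 412 748 800` (BR-4).
[cite: MadrasSlade1993, Definition 1.2.4; lane theorem] -/
theorem thirdShapeSumLow_seven :
    thirdShapeSumLow 4 = 192 ∧ thirdShapeSumLow 5 = 10560 ∧ thirdShapeSumLow 6 = 582400 ∧ thirdShapeSumLow 7 = 35481600 ∧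
      thirdShapeSumLow 8 = 2412748800 := by
  refine ⟨?_, ?_, ?_, ?_, ?_⟩ <;> rw [thirdShapeSumLow_eq _ (by norm_num)] <;> decide

open Classical in
/-- `W'_3 = 0`: on `4` letters with one axis no one-block class member exists (the block `x y x̄ ȳ` needs two axes).
[cite: MadrasSlade1993, Definition 1.2.4; lane lemma] -/
theorem thirdShapeSumLow_three : thirdShapeSumLow 3 = 0 := by
  unfold thirdShapeSumLow
  refine Finset.sum_eq_zero fun A _ => ?_
  split_ifs with h
  · rw [Finset.card_eq_zero, Finset.eq_empty_iff_forall_notMem]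
    intro κ hκ
    obtain ⟨p, hp4, rfl⟩ := exists_eq_topVec_of_mem_shapeClass (by rw [h.2]) hκ
    have hp0 : p = 0 := by omega
    subst hp0
    obtain ⟨-, -, hne⟩ := top_block_general hκ hp4
    -- two distinct axes but only one axis in all
    have hax : numAxes κ + 3 = 2 * 3 - 2 := by
      have hκ' := hκ
      unfold shapeClass at hκ'
      simp only [Finset.mem_filter, Finset.mem_univ, true_and] at hκ'
      exact hκ'.2.1
    rw [numAxes_eq_card_image] at hax
    have h2 : 2 ≤ (Finset.univ.image fun q : Fin (2 * 3 - 2) => (κ q).1).card := by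
      have hsub : ({(κ ⟨0, by omega⟩).1, (κ ⟨0 + 1, by omega⟩).1} : Finset (Fin (2 * 3 - 2))) ⊆ Finset.univ.image fun q : Fin (2 * 3 - 2) => (κ q).1 := by
        intro a ha
        rw [Finset.mem_insert, Finset.mem_singleton] at ha
        rcases ha with rfl | rfl <;> exact Finset.mem_image_of_mem _ (Finset.mem_univ _)
      have := Finset.card_le_card hsub
      rwa [Finset.card_pair hne] at this
    omega
  · rfl

end Count

end WordTypes

end Literature.Probability.RandomPlanarGeometry.SAW.Zd
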